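import Summits.FinalStateConjecture.FinalStateConjecture.Theorems.ClusterCompletenessAdiabaticMultiKerrILEDZoneKinematics

/-!
# Route ClusterCompleteness — crux `AdiabaticMultiKerrILED`, line `Sketch`: zone disjointness

Helper file for the crux `stmt-FinalStateConjecture-14310`
(`Summit.FinalStateConjecture.FinalStateConjecture.Theses.ClusterCompleteness.AdiabaticMultiKerrILED`),
closing the stub `stub_zoneDisjoint` of line `Sketch`: with `|aᵢ| ≤ Mᵢ/2`, future-directed
`4`-velocities, separations `dist(pᵢ, pⱼ) ≥ 40 (Mᵢ + Mⱼ)` at `t = 0` and pairwise strict recession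
`⟨pᵢ − pⱼ, vᵢ − vⱼ⟩ > 0`, the rest-frame balls `{rᵢ ≤ 17 Mᵢ}` of two different holes never meet at a
lab point `x = (t, y)` with `t ≥ 0`.

Proof. Put `dᵢ = y − pᵢ − t vᵢ` (lab displacement from the moving centre `cᵢ(t) = pᵢ + t vᵢ`). The
Lorentz-contraction sandwich (`stub_zoneKinematics`) gives `‖dᵢ‖² ≤ |z⃗ᵢ|²`, and the Kerr–Schild radius
satisfies `|z⃗|² ≤ r² + a²` (`r² = ((ρ² − a²) + √D)/2`, `√D ≥ |ρ² − a²|`); hence `rᵢ ≤ 17 Mᵢ` forces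
`‖dᵢ‖² ≤ 289.25 Mᵢ² < (17.01 Mᵢ)²`. The centres recede:
`‖cᵢ(t) − cⱼ(t)‖² = ‖pᵢ − pⱼ‖² + 2t⟨pᵢ − pⱼ, vᵢ − vⱼ⟩ + t²‖vᵢ − vⱼ‖² ≥ ‖pᵢ − pⱼ‖² ≥ (40 (Mᵢ + Mⱼ))²`,
and `dⱼ − dᵢ = cᵢ(t) − cⱼ(t)`, so `‖dⱼ‖ ≥ 40 (Mᵢ + Mⱼ) − 17.01 Mᵢ > 40 Mⱼ`, whence
`rⱼ² ≥ ‖dⱼ‖² − aⱼ² > 1600 Mⱼ² − Mⱼ²/4 > (17 Mⱼ)²`. Special relativity folklore (O'Neill 1983,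
Ch. 9, pp. 233–236; Visser arXiv:0706.0622, (35) for the radius). [folklore]
-/

noncomputable section

-- the doubled `FinalStateConjecture.FinalStateConjecture` path component trips dupNamespace
set_option linter.dupNamespace false

open scoped InnerProductSpace
open Literature.Geometry.Lorentzian

namespace Summit.FinalStateConjecture.FinalStateConjecture.Cruxes.AdiabaticMultiKerrILED.Sketch

/-- `ρ² ≤ r² + a²` for the Kerr–Schild radius (`r² = ((ρ² − a²) + √D)/2` with `√D ≥ |ρ² − a²|`;
Visser arXiv:0706.0622, (35)). [folklore] -/
private theorem spatialNorm_sq_le_radius_sq_add_sq (a : ℝ) (z : E4) :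
    E4.spatialNorm z ^ 2 ≤ Kerr.radius a z ^ 2 + a ^ 2 := by
  rw [Kerr.radius_sq]
  have h := Kerr.abs_le_sqrt_radius_discr a z
  have h' := le_abs_self (E4.spatialNorm z ^ 2 - a ^ 2)
  linarith

/-- **Zone disjointness for `t ≥ 0`.** With `|aᵢ| ≤ Mᵢ/2`, lab speeds `≤ 1/2`, separations
`≥ 40 (Mᵢ + Mⱼ)` at `t = 0` and pairwise strict recession, the rest-frame balls `{rᵢ ≤ 17 Mᵢ}` of two
different holes never meet at a lab point with `x⁰ ≥ 0` (zone kinematics: `‖y − cᵢ(t)‖² ≤ |z⃗ᵢ|² ≤ rᵢ² + aᵢ²`,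
centres recede). In particular at most one Kerr–Schild term of the patched field is active at each such
point (O'Neill 1983, Ch. 9). [folklore] -/
theorem stub_zoneDisjoint :
    ∀ {N : ℕ} (M a : Fin N → ℝ) (Λ : Fin N → lorentzGroup) (p : Fin N → E3) (u : Fin N → E4)
      (q : Fin N → E4 → E4),
      (∀ i, u i = (Λ i : E4 ≃L[ℝ] E4) (E4.basisVector 0)) →
      (∀ i x, q i x = poincareInv (Λ i) (E4.ofTimeSpace 0 (p i)) x) →
      (∀ i, 0 < M i) → (∀ i, |a i| ≤ 2⁻¹ * M i) →
      (∀ i, 0 < u i 0 ∧ ‖E4.spatial (u i)‖ ≤ 2⁻¹ * u i 0) →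
      (∀ i j, i ≠ j → 40 * (M i + M j) ≤ dist (p i) (p j) ∧
        0 < ⟪p i - p j, (u i 0)⁻¹ • E4.spatial (u i) - (u j 0)⁻¹ • E4.spatial (u j)⟫_ℝ) →
      ∀ x : E4, 0 ≤ x 0 → ∀ i j, i ≠ j →
        Kerr.radius (a i) (q i x) ≤ 17 * M i → 17 * M j < Kerr.radius (a j) (q j x) := by
  intro N M a Λ p u q hu hq hM ha hu0 hsep x hx i j hij hri
  -- write `x = (t, y)`
  have hxe : E4.ofTimeSpace (x 0) (E4.spatial x) = x := E4.ofTimeSpace_time_spatial x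
  -- zone kinematics `‖dₖ‖² ≤ |z⃗ₖ|²` for `k = i, j`
  have hKi := (stub_zoneKinematics (Λ i) (p i) (u i) (q i) (hu i) (hq i) (hu0 i).1 (x 0)
    (E4.spatial x)).1
  have hKj := (stub_zoneKinematics (Λ j) (p j) (u j) (q j) (hu j) (hq j) (hu0 j).1 (x 0)
    (E4.spatial x)).1
  rw [hxe] at hKi hKj
  -- `|z⃗|² ≤ r² + a²`
  have hRi := spatialNorm_sq_le_radius_sq_add_sq (a i) (q i x)
  have hRj := spatialNorm_sq_le_radius_sq_add_sq (a j) (q j x)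
  -- `a² ≤ M²/4`
  have hai : a i ^ 2 ≤ (2⁻¹ * M i) ^ 2 := by
    rw [← sq_abs]; exact pow_le_pow_left₀ (abs_nonneg _) (ha i) 2
  have haj : a j ^ 2 ≤ (2⁻¹ * M j) ^ 2 := by
    rw [← sq_abs]; exact pow_le_pow_left₀ (abs_nonneg _) (ha j) 2
  have hMi := hM i
  have hMj := hM j
  have hri0 := Kerr.radius_nonneg (a i) (q i x)
  have hrj0 := Kerr.radius_nonneg (a j) (q j x)
  -- the two displacements and the relative lab velocity
  set di : E3 := E4.spatial x - p i - (x 0 * (u i 0)⁻¹) • E4.spatial (u i) with hdi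
  set dj : E3 := E4.spatial x - p j - (x 0 * (u j 0)⁻¹) • E4.spatial (u j) with hdj
  set w : E3 := (u i 0)⁻¹ • E4.spatial (u i) - (u j 0)⁻¹ • E4.spatial (u j) with hw
  -- `‖dᵢ‖ < 17.01 Mᵢ`
  have hdi_sq : ‖di‖ ^ 2 ≤ (17 * M i) ^ 2 + (2⁻¹ * M i) ^ 2 := by
    have : Kerr.radius (a i) (q i x) ^ 2 ≤ (17 * M i) ^ 2 := pow_le_pow_left₀ hri0 hri 2
    linarith
  have hdi_lt : ‖di‖ < 1701 / 100 * M i := by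
    refine lt_of_pow_lt_pow_left₀ 2 (by positivity) ?_
    nlinarith
  -- the centres recede: `dⱼ − dᵢ = (pᵢ − pⱼ) + t w`
  have hdiff : dj - di = (p i - p j) + (x 0) • w := by
    simp only [hdi, hdj, hw, smul_sub, mul_smul]
    abel
  have hcen : ‖p i - p j‖ ^ 2 ≤ ‖dj - di‖ ^ 2 := by
    rw [hdiff, norm_add_sq_real, real_inner_smul_right]
    have hrec := (hsep i j hij).2
    have h1 : 0 ≤ x 0 * ⟪p i - p j, w⟫_ℝ := mul_nonneg hx hrec.le
    nlinarith [sq_nonneg ‖(x 0) • w‖]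
  have hcen' : ‖p i - p j‖ ≤ ‖dj - di‖ := le_of_pow_le_pow_left₀ two_ne_zero (norm_nonneg _) hcen
  have hdist : 40 * (M i + M j) ≤ ‖p i - p j‖ := by
    rw [← dist_eq_norm]; exact (hsep i j hij).1
  -- triangle inequality: `‖dⱼ‖ ≥ ‖dⱼ − dᵢ‖ − ‖dᵢ‖ > 40 Mⱼ`
  have htri : ‖dj - di‖ ≤ ‖dj‖ + ‖di‖ := norm_sub_le _ _
  have hdj_gt : 40 * M j < ‖dj‖ := by linarith
  have hdj_sq : (40 * M j) ^ 2 < ‖dj‖ ^ 2 := pow_lt_pow_left₀ hdj_gt (by positivity) two_ne_zero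
  -- conclude: `rⱼ² ≥ ‖dⱼ‖² − aⱼ² > (17 Mⱼ)²`
  refine lt_of_pow_lt_pow_left₀ 2 hrj0 ?_
  nlinarith
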